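import Literature.NumberTheory.EllipticCurves.FineSelmerRestrictionDescentProofs
import Literature.NumberTheory.EllipticCurves.FineSelmerClassGroupCriterion
import Literature.NumberTheory.EllipticCurves.GoodReductionUnramifiedProofs
import Literature.NumberTheory.GaloisRepresentations.BrauerHassePrinciple
import Mathlib.GroupTheory.PGroup
import HarnessLib

/-!
# Lim 2017 Thm. 3.5 (the `L`-form of Coates–Sujatha 2005 Thm. 3.4) for elliptic curves over `ℚ`
# FOLLOWS from the character form of Iwasawa's `μ = 0` (proved; no definition, no named fact)

`Proofs` file (theorems only) in topic `NumberTheory/EllipticCurves` (namespace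
`Literature.NumberTheory.EllipticCurves.FineSelmerPExtensionDescent`), written by the prover seat
`bsd-potss-rkm` g33 (cell `bsd-potss`; item stmt-BirchSwinnertonDyer-19196; `--supports`; closes nothing).

Lim's theorem («`F(μ_{2p}, T/𝔪T)` contained in a finite `p`-extension of `L`; then `μ(L^{cyc}) = 0`
⟹ `Y(T/F^{cyc})` finitely generated») is printed via Iwasawa's ascent of `μ = 0` in `p`-extensions
(Iwasawa 1973). For the Tate module of an elliptic curve over `ℚ` (the tree's named fact
`Lim2017.thm35_fineSelmerDual_moduleFinite_of_classicalMuVanishes_of_le_divisionField`: `L ≤ ℚ(E[p])`,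
`[ℚ(E[p]) : ℚ] = p^k [L : ℚ]`) the ascent is not needed: `Gal(ℚ(E[p])/L)` is a `p`-GROUP, so it fixes a
non-zero vector of `E[p] ≅ 𝔽_p²` and acts trivially on the quotient line (fixed-point congruence for
`p`-groups, twice); i.e. `E[p]` is unipotent of level two over `L`, and the descent
`FineSelmerRestrictionDescent.finite_fineSelmerInfty_of_unipotent_restrict` (dévissage over `L`, restriction
to `ℚ`) gives `Sel₀(ℚ_∞, E[p])` finite from the character form of Iwasawa's `μ = 0`
(`IwasawaTheory.classicalMuVanishes_finite_unramifiedClasses`) and `ClassicalMuVanishes` of `L`'s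
cyclotomic `ℤ_p`-extension; the Lim–Sujatha bricks turn that into statement (A).

* `card_map_toAddAut_range_absGaloisRestrict` — `#` (image of `res Γ_L` in `Aut E[p]`) `= p^k`.
* `exists_flag_of_isPGroup` — a `p`-group of automorphisms of a group of order `p²` fixes a subgroup
  `C ≠ 0` pointwise and acts trivially modulo `C`.
* **`thm35_of_classicalMuVanishes_finite_unramifiedClasses :
  classicalMuVanishes_finite_unramifiedClasses → Lim2017.thm35_…`**.

References: [Lim2017FineSelmer] §3 Thm. 3.5, Lemma 3.2, Remark (a); [CoatesSujatha2005] §3 Thm. 3.4,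
Cor. 3.5; [Iwasawa1973MuInvariants] (the ascent, NOT used); [SerreLocalFields1979] IX §1 (fixed points
of `p`-groups); [Lang1990] Ch. 5 §§1–4.
-/

set_option autoImplicit false

noncomputable section

open scoped Classical Pointwise

namespace Literature.NumberTheory.EllipticCurves.FineSelmerPExtensionDescent

open NumberField IsDedekindDomain Field WeierstrassCurve
open Literature.NumberTheory.EllipticCurves Literature.NumberTheory.EllipticCurves.GreenbergSelmer
  Literature.NumberTheory.EllipticCurves.FineSelmerRestrictionDescent
  Literature.NumberTheory.GaloisRepresentations Literature.NumberTheory.IwasawaTheory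
  Literature.NumberTheory.GaloisRepresentations.LocalWeilDatum

/-! ## §1 A `p`-group of additive permutations of a group of order `p²` is unipotent of level two -/

section PGroup

variable {p : ℕ} [Fact p.Prime]
variable {M : Type} [AddCommGroup M] [Finite M]

/-- **Fixed flag of a `p`-group.** Let `G ≤ Perm(M)` be a `p`-group of ADDITIVE bijections of an
abelian group `M` of order `p²`. Then there is a subgroup `C ≠ 0` of `M` fixed pointwise by `G` such that
`G` acts trivially on `M/C` (`g m − m ∈ C`): the fixed-point congruence `#X ≡ #X^G (mod p)` applied to
`X = M` (a non-zero fixed vector) and to `X = M/C` (every coset is fixed).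
[cite: SerreLocalFields1979, Ch. IX §1 (Thm. 1 and its corollary: a p-group acting on a p-group has non-trivial fixed points)] -/
theorem exists_flag_of_isPGroup (G : Subgroup (Equiv.Perm M)) (hG : IsPGroup p G)
    (hadd : ∀ g ∈ G, ∀ x y : M, g (x + y) = g x + g y) (hM : Nat.card M = p ^ 2) :
    ∃ C : AddSubgroup M, C ≠ ⊥ ∧ (∀ g ∈ G, ∀ m ∈ C, g m = m) ∧ ∀ g ∈ G, ∀ m : M, g m - m ∈ C := by
  have hpr : p.Prime := Fact.out
  have hpM : p ∣ Nat.card M := by rw [hM, pow_two]; exact dvd_mul_right p p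
  -- additive maps: as homomorphisms
  have hzero : ∀ g ∈ G, g (0 : M) = 0 := fun g hg ↦ by
    have h := hadd g hg 0 0
    rw [add_zero] at h
    exact left_eq_add.1 h
  let φ : ∀ g ∈ G, M →+ M := fun g hg ↦
    { toFun := fun m ↦ g m, map_zero' := hzero g hg, map_add' := hadd g hg }
  have hφ : ∀ g (hg : g ∈ G) (m : M), φ g hg m = g m := fun _ _ _ ↦ rfl
  -- a non-zero fixed vector
  have h0 : (0 : M) ∈ MulAction.fixedPoints G M := fun g ↦ hzero g g.2
  obtain ⟨b, hb, hb0⟩ := hG.exists_fixed_point_of_prime_dvd_card_of_fixed_point M hpM h0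
  have hfix : ∀ g ∈ G, g b = b := fun g hg ↦ hb ⟨g, hg⟩
  -- the subgroup of `G`-fixed points
  let C : AddSubgroup M :=
    { carrier := {m | ∀ g ∈ G, g m = m}
      zero_mem' := fun g hg ↦ hzero g hg
      add_mem' := fun {x y} hx hy g hg ↦ by rw [hadd g hg, hx g hg, hy g hg]
      neg_mem' := fun {x} hx g hg ↦ by rw [← hφ g hg, map_neg, hφ g hg, hx g hg] }
  have hmemC : ∀ m : M, m ∈ C ↔ ∀ g ∈ G, g m = m := fun _ ↦ Iff.rfl
  have hbC : b ∈ C := (hmemC b).2 hfix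
  have hCbot : C ≠ ⊥ := fun h ↦ hb0 (by rw [h, AddSubgroup.mem_bot] at hbC; exact hbC.symm)
  refine ⟨C, hCbot, fun g hg m hm ↦ hm g hg, ?_⟩
  by_cases hCtop : C = ⊤
  · intro g _ m
    rw [hCtop]; exact AddSubgroup.mem_top _
  -- `#C = p`, `#(M ⧸ C) = p`
  have hcardC : Nat.card C = p := by
    have hdvd : Nat.card C ∣ p ^ 2 := hM ▸ AddSubgroup.card_addSubgroup_dvd_card C
    obtain ⟨j, hj, hjC⟩ := (Nat.dvd_prime_pow hpr).1 hdvd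
    interval_cases j
    · exfalso; apply hCbot
      rw [pow_zero] at hjC
      exact AddSubgroup.eq_bot_of_card_eq C hjC
    · rw [hjC, pow_one]
    · exfalso; apply hCtop
      exact AddSubgroup.eq_top_of_card_eq C (by rw [hjC, hM])
  have hcardQ : Nat.card (M ⧸ C) = p := by
    have h := AddSubgroup.card_eq_card_quotient_mul_card_addSubgroup C
    rw [hM, hcardC, pow_two] at h
    exact (Nat.eq_of_mul_eq_mul_right hpr.pos h).symm
  -- `G` acts on `M ⧸ C`
  have hstab : ∀ (g : G) (x : M), x ∈ C → φ g g.2 x ∈ C := fun g x hx ↦ by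
    rw [hφ g g.2, hx g g.2]; exact hx
  letI instQ : MulAction G (M ⧸ C) :=
    { smul := fun g ↦ QuotientAddGroup.map C C (φ g g.2)
        (fun x hx ↦ AddSubgroup.mem_comap.2 (hstab g x hx))
      one_smul := fun q ↦ QuotientAddGroup.induction_on q fun m ↦ by
        change QuotientAddGroup.map C C (φ (1 : G) (1 : G).2) _ (m : M ⧸ C) = _
        rw [QuotientAddGroup.map_mk]
        rfl
      mul_smul := fun g h q ↦ QuotientAddGroup.induction_on q fun m ↦ by
        change QuotientAddGroup.map C C (φ (g * h : G) (g * h).2) _ (m : M ⧸ C) =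
          QuotientAddGroup.map C C (φ g g.2) _ (QuotientAddGroup.map C C (φ h h.2) _ (m : M ⧸ C))
        rw [QuotientAddGroup.map_mk, QuotientAddGroup.map_mk, QuotientAddGroup.map_mk]
        rfl }
  have hsmulQ : ∀ (g : G) (m : M), g • (m : M ⧸ C) = (((g : Equiv.Perm M) m : M) : M ⧸ C) :=
    fun g m ↦ rfl
  -- every coset is fixed
  have hall : ∀ q : M ⧸ C, q ∈ MulAction.fixedPoints G (M ⧸ C) := by
    by_contra hne
    push Not at hne
    obtain ⟨q, hq⟩ := hne
    have hlt : Nat.card (MulAction.fixedPoints G (M ⧸ C)) < Nat.card (M ⧸ C) :=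
      Finite.card_subtype_lt (p := fun x ↦ x ∈ MulAction.fixedPoints G (M ⧸ C)) hq
    have hmod := hG.card_modEq_card_fixedPoints (M ⧸ C)
    rw [hcardQ] at hmod hlt
    have hdvd : p ∣ Nat.card (MulAction.fixedPoints G (M ⧸ C)) :=
      (Nat.modEq_zero_iff_dvd.1 (hmod.symm.trans (Nat.modEq_zero_iff_dvd.2 dvd_rfl)))
    have hpos : 0 < Nat.card (MulAction.fixedPoints G (M ⧸ C)) := by
      haveI : Nonempty (MulAction.fixedPoints G (M ⧸ C)) :=
        ⟨⟨((0 : M) : M ⧸ C), fun g ↦ by rw [hsmulQ, hzero g g.2]⟩⟩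
      exact Nat.card_pos
    exact absurd (Nat.le_of_dvd hpos hdvd) (not_le.2 hlt)
  intro g hg m
  have h := hall (m : M ⧸ C) ⟨g, hg⟩
  rw [hsmulQ] at h
  exact QuotientAddGroup.eq_iff_sub_mem.1 h

end PGroup

/-! ## §2 Over a number field: `Sel₀(K_∞, E[p])` finite from the classical `μ = 0` of any `L ≤ K(E[p])`
of `p`-power index -/

section NumberFieldCase

/-- **`Sel₀(K_∞, E[p])` is finite when `μ(L_cyc) = 0` for some `L ⊆ K(E[p])` with `[K(E[p]) : L]` a
power of `p`** (number field `K`, `p` odd, `κ` cyclotomic; modulo the character form of Iwasawa's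
`μ = 0`). The image of `res Γ_L` in `Perm(E[p])` has order `[K(E[p]) : L] = p^k` (`res Γ_L` is a
conjugate of `Gal(K̄/L) ⊇ Gal(K̄/K(E[p]))`), hence is unipotent of level two (§1), and
`FineSelmerRestrictionDescent.finite_fineSelmerInfty_of_unipotent_restrict` applies (`E[p]` is unramified
outside `{v ∣ p} ∪ {bad v}`, AEC VII.4.1). [cite: Lim2017FineSelmer, §3 Thm. 3.5, Lemma 3.2]
[cite: CoatesSujatha2005, Thm. 3.4, Cor. 3.5] [cite: SilvermanAEC2009, Prop. VII.4.1(a)] -/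
theorem fineSelmerInfty_torsion_finite_of_le_divisionField
    (hchar : classicalMuVanishes_finite_unramifiedClasses)
    {K : Type} [Field K] [NumberField K] (W : WeierstrassCurve K) [W.IsElliptic]
    {p : ℕ} [Fact p.Prime] (hp : p ≠ 2) (κ : ZpExtension K p) (hκ : κ.IsCyclotomic)
    (L : IntermediateField K (AlgebraicClosure K))
    (hL : haveI : NeZero p := ⟨(Fact.out : p.Prime).ne_zero⟩; L ≤ W.divisionField p)
    (k : ℕ) (hk : haveI : NeZero p := ⟨(Fact.out : p.Prime).ne_zero⟩;
      Module.finrank K (W.divisionField p) = p ^ k * Module.finrank K L)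
    (hμ : ∀ κL : ZpExtension L p, κL.IsCyclotomic → ClassicalMuVanishes κL) :
    (fineSelmerInfty (↥(W.geomTorsion (p : ℤ))) κ :
      Set (subgroupH1 κ.kerSubgroup (W.geomTorsion (p : ℤ)))).Finite := by
  have hpr : p.Prime := Fact.out
  haveI : NeZero p := ⟨hpr.ne_zero⟩
  have hodd : Odd p := hpr.odd_of_ne_two hp
  haveI : IsGalois K (AlgebraicClosure K) := {}
  -- the module `E[p]`
  haveI hfinM : Finite (W.geomTorsion (p : ℤ)) := W.finite_geomTorsion_nat (NeZero.ne p)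
  haveI : ContinuousSMul (absoluteGaloisGroup K) (W.geomTorsion (p : ℤ)) :=
    W.continuousSMul_geomTorsion W.isOpen_stabilizer_point_holds p
  have hV : Nat.card (W.geomTorsion (p : ℤ)) = p ^ 2 := W.natCard_geomTorsion_eq_sq_of_charZero hpr
  have hMp : ∀ m : W.geomTorsion (p : ℤ), p • m = 0 := fun m ↦ by
    apply Subtype.ext
    rw [AddSubgroupClass.coe_nsmul, ← natCast_zsmul]
    exact m.2
  -- the field `L`
  haveI : FiniteDimensional K L :=
    Module.Finite.of_injective (IntermediateField.inclusion hL).toLinearMap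
      (IntermediateField.inclusion_injective hL)
  haveI : NumberField L := NumberField.of_module_finite K L
  obtain ⟨κL, hκL⟩ := ZpExtension.exists_isCyclotomic_holds L p
    (GaloisRep.cyclotomicCharacter_range_infinite L p)
  have hμL : ClassicalMuVanishes κL := hμ κL hκL
  -- `E[p]` is unramified outside the places above `p` and the bad places
  have hSfin : ({v : HeightOneSpectrum (𝓞 K) | (p : 𝓞 K) ∈ v.asIdeal} ∪ W.badPlaces (𝓞 K)).Finite := by
    refine Set.Finite.union ?_ (W.finite_badPlaces_holds (𝓞 K))
    have hne : Ideal.span {(p : 𝓞 K)} ≠ 0 := by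
      rw [Ideal.zero_eq_bot, Ne, Ideal.span_singleton_eq_bot]
      exact_mod_cast hpr.ne_zero
    refine (Ideal.finite_factors hne).subset fun v hv ↦ ?_
    simp only [Set.mem_setOf_eq] at hv ⊢
    exact Ideal.dvd_iff_le.mpr ((Ideal.span_singleton_le_iff_mem _).mpr hv)
  have hunr : ∀ v ∉ ({v : HeightOneSpectrum (𝓞 K) | (p : 𝓞 K) ∈ v.asIdeal} ∪ W.badPlaces (𝓞 K)),
      ∀ 𝔓 ∈ v.primesAbove, ∀ σ ∈ 𝔓.inertia (absoluteGaloisGroup K),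
        ∀ m : W.geomTorsion (p : ℤ), σ • m = m := by
    intro v hv 𝔓 h𝔓 σ hσ m
    rw [Set.mem_union, not_or, Set.mem_setOf_eq, WeierstrassCurve.mem_badPlaces_iff, not_not] at hv
    exact W.smul_geomTorsion_eq_of_mem_inertia hv.2 (n := (p : ℤ)) (by exact_mod_cast hv.1) h𝔓 hσ m
  -- the image of `res Γ_L` in `Perm(E[p])` is a `p`-group of order `p^k`
  -- `res Γ_L` is conjugate to `Gal(K̄/L)`
  obtain ⟨τ, hτ⟩ := exists_range_absGaloisRestrict_eq_map_conj (F := K) L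
  set Γ' : Subgroup (absoluteGaloisGroup K) := (galFixing K L).map (MulAut.conj τ).toMonoidHom
    with hΓ'def
  have hmemΓ' : ∀ σ : absoluteGaloisGroup L, absGaloisRestrict K L σ ∈ Γ' := fun σ ↦ by
    rw [← hτ]; exact ⟨σ, rfl⟩
  let Φ : absoluteGaloisGroup K →* Equiv.Perm (W.geomTorsion (p : ℤ)) :=
    MulAction.toPermHom (absoluteGaloisGroup K) (W.geomTorsion (p : ℤ))
  have hΦ : ∀ (σ : absoluteGaloisGroup K) (m : W.geomTorsion (p : ℤ)), Φ σ m = σ • m := fun _ _ ↦ rfl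
  set G : Subgroup (Equiv.Perm (W.geomTorsion (p : ℤ))) := Γ'.map Φ with hGdef
  have hadd : ∀ g ∈ G, ∀ x y : W.geomTorsion (p : ℤ), g (x + y) = g x + g y := by
    rintro _ ⟨σ, -, rfl⟩ x y
    rw [hΦ, hΦ, hΦ, smul_add]
  -- `ker Φ = Γ_{K(E[p])}`
  set Fx : Subgroup (absoluteGaloisGroup K) := fixingSubgroupOfModule K (W.geomTorsion (p : ℤ)) with hFx
  have hker : Φ.ker = Fx := by
    ext σ
    rw [MonoidHom.mem_ker, hFx, W.mem_fixingSubgroupOfModule_geomTorsion_iff p, Equiv.ext_iff]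
    exact Iff.rfl
  haveI hFxn : Fx.Normal := W.fixingSubgroupOfModule_geomTorsion_normal p
  have hgF : galFixing K L = (L.fixingSubgroup : Subgroup (absoluteGaloisGroup K)) := by
    ext σ
    rw [mem_galFixing_iff]
    exact (IntermediateField.mem_fixingSubgroup_iff L (absoluteGaloisGroup.toAlgEquiv K σ)).symm
  have hFxle : Fx ≤ galFixing K L := by
    intro σ hσ
    rw [hFx, ← W.fixingSubgroup_divisionField p] at hσ
    rw [mem_galFixing_iff]
    intro x hx
    exact (IntermediateField.mem_fixingSubgroup_iff _ (absoluteGaloisGroup.toAlgEquiv K σ)).1 hσ x (hL hx)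
  have hFxconj : Fx.map (MulAut.conj τ).toMonoidHom = Fx := by
    ext x
    constructor
    · rintro ⟨y, hy, rfl⟩
      exact hFxn.conj_mem y hy τ
    · intro hx
      refine ⟨τ⁻¹ * x * τ⁻¹⁻¹, hFxn.conj_mem x hx τ⁻¹, ?_⟩
      simp only [MulEquiv.coe_toMonoidHom, MulAut.conj_apply, inv_inv]
      group
  have hrel : Fx.relIndex Γ' = p ^ k := by
    have h1 : Fx.relIndex Γ' = Fx.relIndex (galFixing K L) := by
      rw [hΓ'def]
      conv_lhs => rw [← hFxconj]
      exact Subgroup.relIndex_map_map_of_injective _ _ (MulAut.conj τ).injective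
    have h2 : Fx.relIndex (galFixing K L) * (galFixing K L).index = Fx.index :=
      Subgroup.relIndex_mul_index hFxle
    have h3 : (galFixing K L).index = Module.finrank K L := by
      rw [hgF]; exact (IntermediateField.finrank_eq_fixingSubgroup_index L).symm
    have h4 : Fx.index = Module.finrank K (W.divisionField p) := (W.finrank_divisionField (p := p)).symm
    rw [h3, h4, hk] at h2
    rw [h1]
    exact Nat.eq_of_mul_eq_mul_right Module.finrank_pos h2
  have hcardG : Nat.card G = p ^ k := by
    rw [hGdef, ← Subgroup.relIndex_ker, hker, hrel]
  have hG : IsPGroup p G := IsPGroup.of_card hcardG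
  obtain ⟨C, -, hC1', hC2'⟩ := exists_flag_of_isPGroup G hG hadd hV
  have hresG : ∀ σ : absoluteGaloisGroup L, Φ (absGaloisRestrict K L σ) ∈ G :=
    fun σ ↦ ⟨absGaloisRestrict K L σ, hmemΓ' σ, rfl⟩
  have hC1 : ∀ (σ : absoluteGaloisGroup L) (m : W.geomTorsion (p : ℤ)), m ∈ C →
      absGaloisRestrict K L σ • m = m :=
    fun σ m hm ↦ by rw [← hΦ]; exact hC1' _ (hresG σ) m hm
  have hC2 : ∀ (σ : absoluteGaloisGroup L) (m : W.geomTorsion (p : ℤ)),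
      absGaloisRestrict K L σ • m - m ∈ C :=
    fun σ m ↦ by rw [← hΦ]; exact hC2' _ (hresG σ) m
  exact finite_fineSelmerInfty_of_unipotent_restrict hchar hodd κ hκ κL hκL hμL hMp ⟨2, hV⟩ _ hSfin
    hunr C hC1 hC2

end NumberFieldCase

/-! ## §3 Lim 2017 Thm. 3.5 for elliptic curves over `ℚ`, from the character form of `μ = 0` -/

/-- **Lim 2017 Thm. 3.5 (the `L`-form of Coates–Sujatha 2005 Thm. 3.4) for the Tate module of an elliptic
curve over `ℚ` — the named fact `Lim2017.thm35_fineSelmerDual_moduleFinite_of_classicalMuVanishes_of_le_divisionField`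
— FOLLOWS from the character form of Iwasawa's `μ = 0`
(`IwasawaTheory.classicalMuVanishes_finite_unramifiedClasses`).** No ascent of `μ = 0` along
`ℚ(E[p])/L` (Iwasawa 1973) is used: `Gal(ℚ(E[p])/L)` is a `p`-group, hence unipotent on `E[p]`, and
the dévissage descends. [cite: Lim2017FineSelmer, §3 Thm. 3.5, Lemma 3.2, Remarks (a)]
[cite: CoatesSujatha2005, Thm. 3.4, Cor. 3.5] [cite: SerreLocalFields1979, Ch. IX §1 (fixed points of p-groups)] -/
theorem thm35_of_classicalMuVanishes_finite_unramifiedClasses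
    (hchar : classicalMuVanishes_finite_unramifiedClasses) :
    Lim2017.thm35_fineSelmerDual_moduleFinite_of_classicalMuVanishes_of_le_divisionField := by
  intro W _ p _ hp L hL hk hμ κ hκ
  rw [LimSujatha2018.fineSelmerDual_moduleFinite_iff_finite_fineSelmerInfty_torsion W hp κ hκ]
  obtain ⟨k, hk⟩ := hk
  exact fineSelmerInfty_torsion_finite_of_le_divisionField hchar W hp κ hκ L hL k hk hμ

end Literature.NumberTheory.EllipticCurves.FineSelmerPExtensionDescent

end
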